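import Literature.AlgebraicGeometry.Resolution.KummerToricAlgebra
import Literature.AlgebraicGeometry.Resolution.KummerRootCoverRegular
import Literature.AlgebraicGeometry.Resolution.RegularLocalRingsNormal
import HarnessLib

/-!
# The Kummer toric algebra over a (regular) local base: locality, the monomial ideal, structure

Topic: `Literature/AlgebraicGeometry/Resolution`. Sequel to `KummerToricAlgebra.lean` (the toric
algebra `T` of the normalised Kummer cover `τ^p = x^c` inside the root cover
`B' = O[s]/(s^p - x)`) and `KummerRootCoverRegular.lean` (`B'` is (regular) local). Proved here:

* `RootCover.toric_isLocalRing` — over a local base with `x_j ∈ 𝔪`, `T` is local, its maximal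
  ideal the trace of that of `B'` (lying over for the integral extension `T ⊆ B'`);
* `RootCover.toricIdeal` — the MONOMIAL IDEAL `I ⊆ T` (non-empty Kummer monomials and the
  `x_j`): Kato's `I(x, M)` for the Kummer chart at the closed point; `RootCover.toricAugment`,
  `ker_toricAugment`, `toricQuotientEquiv : T/I ≅ O/(x)`;
* `RootCover.ringKrullDim_toric` — `dim T = dim O`;
* `RootCover.toric_structure` — over a REGULAR local base with `x` independent modulo `𝔪²`:
  `T` is a local integrally closed domain, `T/I` is regular and `dim T/I + r = dim T`
  (K. Kato, *Toric singularities*, Amer. J. Math. 116 (1994), Def. (2.1) with (2.2)(2), and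
  Thm. (4.1) for this chart).

Sources: [Kato1994] K. Kato, Amer. J. Math. 116 (1994), Def. (2.1), (2.2)(2), Thm. (4.1).
[Matsumura1987] H. Matsumura, *Commutative Ring Theory*, Thm. 14.2.
-/

noncomputable section

namespace Literature.AlgebraicGeometry.Resolution

open MvPolynomial IsLocalRing

namespace RootCover

variable {O : Type*} [CommRing O] {r : ℕ} {p : ℕ} [hp : Fact p.Prime] {x : Fin r → O}
variable {j₀ : Fin r} {c : Fin r → ℕ}

/-- The root cover is integral over the toric algebra. [folklore] -/
instance isIntegral_toric : Algebra.IsIntegral (toric p x j₀ c) (RootCover p x) := by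
  haveI : Algebra.IsIntegral O (RootCover p x) := inferInstance
  exact Algebra.IsIntegral.tower_top (R := O)

/-! ## Locality -/

/-- **The toric algebra of a local ring at elements of the maximal ideal is local**, with
maximal ideal the trace of that of the (local) root cover: every maximal ideal of `T` lies
under a maximal ideal of the integral extension `B'`, and `B'` has only one.
[cite: Kato1994, (2.2)(2)] -/
theorem toric_isLocalRing [IsLocalRing O] (hx : ∀ j, x j ∈ maximalIdeal O) :
    ∃ (_ : IsLocalRing (RootCover p x)) (_ : IsLocalRing (toric p x j₀ c)),
      maximalIdeal (toric p x j₀ c) =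
        (maximalIdeal (RootCover p x)).comap (algebraMap (toric p x j₀ c) (RootCover p x)) := by
  obtain ⟨hloc, -⟩ := isLocalRing (p := p) hx
  haveI := hloc
  set 𝔫₀ : Ideal (toric p x j₀ c) :=
    (maximalIdeal (RootCover p x)).comap (algebraMap (toric p x j₀ c) (RootCover p x))
  have h𝔫₀ : 𝔫₀.IsMaximal := Ideal.isMaximal_comap_of_isIntegral_of_isMaximal _
  have hunique : ∀ 𝔫 : Ideal (toric p x j₀ c), 𝔫.IsMaximal → 𝔫 = 𝔫₀ := by
    intro 𝔫 h𝔫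
    obtain ⟨𝔑, h𝔑, hcomap⟩ := Ideal.exists_ideal_over_maximal_of_isIntegral 𝔫 (by
      rw [(RingHom.injective_iff_ker_eq_bot _).mp Subtype.val_injective]; exact bot_le)
    rw [← hcomap, IsLocalRing.eq_maximalIdeal h𝔑]
  haveI : IsLocalRing (toric p x j₀ c) := IsLocalRing.of_unique_max_ideal ⟨𝔫₀, h𝔫₀, hunique⟩
  exact ⟨hloc, inferInstance, hunique _ (maximalIdeal.isMaximal _)⟩

/-! ## The monomial ideal and the quotient `T/I ≅ O/(x)` -/

variable (p x j₀ c) in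
/-- **The monomial ideal** `I` of the toric algebra: generated by the non-empty Kummer monomials
and the `x_j` (Kato's `I(x, M)` for the Kummer chart at the closed point).
[cite: Kato1994, Def. (2.1)] -/
def toricIdeal : Ideal (toric p x j₀ c) :=
  Ideal.span (Set.range fun n : {n : Fin r → Fin p // IsKummerExp p j₀ c n ∧ n ≠ 0} =>
      kummerMonomial p x j₀ c ⟨n.1, n.2.1⟩) ⊔
    (Ideal.span (Set.range x)).map (algebraMap O (toric p x j₀ c))

variable (p x j₀ c) in
/-- The augmentation of the toric algebra onto `O/(x)` (all monomials `↦ 0`). [folklore] -/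
def toricAugment : toric p x j₀ c →ₐ[O] O ⧸ Ideal.span (Set.range x) :=
  (augment p x hp.out.pos).comp (toric p x j₀ c).val

/-- The augmentation reads off the coordinate at the empty monomial. [folklore] -/
theorem toricAugment_apply (t : toric p x j₀ c) :
    toricAugment p x j₀ c t = Ideal.Quotient.mk _ (coord (t : RootCover p x) 0) :=
  augment_eq_mk_coord_zero (t : RootCover p x)

/-- The augmentation of the toric algebra is surjective. [folklore] -/
theorem toricAugment_surjective : Function.Surjective (toricAugment p x j₀ c) := by
  intro b
  obtain ⟨a, rfl⟩ := Ideal.Quotient.mk_surjective b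
  exact ⟨algebraMap O _ a, by rw [AlgHom.commutes]; rfl⟩

/-- The empty Kummer monomial is `1`. [folklore] -/
theorem kummerMonomial_zero : kummerMonomial p x j₀ c ⟨0, isKummerExp_zero⟩ = 1 :=
  Subtype.ext (by simp [boxMonomial])

/-- **The kernel of the augmentation is the monomial ideal.** [cite: Kato1994, Def. (2.1)] -/
theorem ker_toricAugment : RingHom.ker (toricAugment p x j₀ c) = toricIdeal p x j₀ c := by
  classical
  apply le_antisymm
  · intro t ht
    rw [RingHom.mem_ker, toricAugment_apply, Ideal.Quotient.eq_zero_iff_mem] at ht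
    rw [← sum_coord_smul_kummerMonomial t,
      ← Finset.sum_erase_add _ _ (Finset.mem_univ (⟨0, isKummerExp_zero⟩ : {n // IsKummerExp p j₀ c n}))]
    refine Ideal.add_mem _ (Ideal.sum_mem _ fun n hn => ?_) ?_
    · refine Ideal.mem_sup_left ?_
      rw [Algebra.smul_def]
      refine Ideal.mul_mem_left _ _ (Ideal.subset_span ⟨⟨n.1, n.2, fun h0 => ?_⟩, rfl⟩)
      exact Finset.ne_of_mem_erase hn (Subtype.ext h0)
    · refine Ideal.mem_sup_right ?_
      rw [kummerMonomial_zero, Algebra.smul_def, mul_one]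
      exact Ideal.mem_map_of_mem _ ht
  · refine sup_le (Ideal.span_le.mpr ?_) (Ideal.map_le_iff_le_comap.mpr (Ideal.span_le.mpr ?_))
    · rintro _ ⟨n, rfl⟩
      rw [SetLike.mem_coe, RingHom.mem_ker, toricAugment_apply, coe_kummerMonomial,
        coord_boxMonomial, Pi.single_eq_of_ne n.2.2.symm, map_zero]
    · rintro _ ⟨j, rfl⟩
      rw [SetLike.mem_coe, Ideal.mem_comap, RingHom.mem_ker, AlgHom.commutes,
        Ideal.Quotient.algebraMap_eq, Ideal.Quotient.eq_zero_iff_mem]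
      exact Ideal.subset_span ⟨j, rfl⟩

variable (p x j₀ c) in
/-- **`T/I ≅ O/(x)`**: the toric algebra modulo its monomial ideal is the base modulo the
boundary equations. [cite: Kato1994, Def. (2.1)] -/
def toricQuotientEquiv : (toric p x j₀ c ⧸ toricIdeal p x j₀ c) ≃ₐ[O] O ⧸ Ideal.span (Set.range x) :=
  (Ideal.quotientEquivAlgOfEq O (ker_toricAugment (p := p) (x := x) (j₀ := j₀) (c := c)).symm).trans
    (Ideal.quotientKerAlgEquivOfSurjective toricAugment_surjective)

/-! ## Dimension and the structure theorem over a regular local base -/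

/-- The structure map `O → T` is injective. [folklore] -/
theorem algebraMap_toric_injective : Function.Injective (algebraMap O (toric p x j₀ c)) := by
  intro a b hab
  apply algebraMap_injective (p := p) (x := x)
  have := congrArg (algebraMap (toric p x j₀ c) (RootCover p x)) hab
  rwa [← IsScalarTower.algebraMap_apply, ← IsScalarTower.algebraMap_apply] at this

/-- **The toric algebra has the dimension of the base** (an integral, faithful extension).
[folklore] -/
theorem ringKrullDim_toric : ringKrullDim (toric p x j₀ c) = ringKrullDim O := by
  haveI : Algebra.IsIntegral O (toric p x j₀ c) := inferInstance
  exact (Literature.RingTheory.KrullDimension.ringKrullDim_eq_of_isIntegral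
    algebraMap_toric_injective).symm

/-- **Structure of the Kummer toric algebra over a regular local base.** For a regular local
ring `O` and boundary equations `x_j ∈ 𝔪` independent modulo `𝔪²`, the toric algebra `T` of
the normalised Kummer cover `τ^p = x^c` is a local, integrally closed domain of dimension
`dim O`, and modulo its monomial ideal it is the regular local ring `O/(x)` of dimension
`dim O - r` — Kato's condition (2.1) for the Kummer chart at the closed point:
`T/I` regular and `dim T = dim T/I + r`. [cite: Kato1994, Def. (2.1) and Thm. (4.1)] -/
theorem toric_structure [IsRegularLocalRing O] (hx : ∀ j, x j ∈ maximalIdeal O)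
    (hli : ∀ α : Fin r → O, ∑ i, α i * x i ∈ maximalIdeal O ^ 2 → ∀ i, α i ∈ maximalIdeal O) :
    ∃ (_ : IsLocalRing (toric p x j₀ c)) (_ : IsDomain (toric p x j₀ c)),
      IsIntegrallyClosed (toric p x j₀ c) ∧
      IsRegularLocalRing (toric p x j₀ c ⧸ toricIdeal p x j₀ c) ∧
      ringKrullDim (toric p x j₀ c ⧸ toricIdeal p x j₀ c) + r = ringKrullDim (toric p x j₀ c) := by
  obtain ⟨hregB, -⟩ := isRegularLocalRing (p := p) hx hli
  haveI := hregB
  haveI := isDomain_of_isRegularLocalRing (RootCover p x)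
  haveI := isIntegrallyClosed_of_isRegularLocalRing (RootCover p x)
  obtain ⟨_, hlocT, -⟩ := toric_isLocalRing (p := p) (j₀ := j₀) (c := c) hx
  haveI : IsDomain (toric p x j₀ c) := Subalgebra.isDomain _
  obtain ⟨hregQ, hdimQ⟩ := RegularParameters.isRegularLocalRing_quotient_span_range x hx hli
  let e := (toricQuotientEquiv p x j₀ c).toRingEquiv
  refine ⟨hlocT, inferInstance, isIntegrallyClosed_toric, IsRegularLocalRing.of_ringEquiv e.symm, ?_⟩
  rw [ringKrullDim_eq_of_ringEquiv e, ringKrullDim_toric, hdimQ]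

end RootCover

end Literature.AlgebraicGeometry.Resolution

end
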